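import Summits.BirchSwinnertonDyer.Rank1Residual.Additive.RamifiedSevenRationalComparisonOfInputs
import HarnessLib

set_option autoImplicit false

/-!
# `𝒞₇` genus road (crux `EllipticUnitValueSevenOfGZK`, K7r), row (K2C-2) ASSEMBLY (pen D914/D916): THE PINNED INTEGRAL
# COMPARISON `stub_integralComparisonSeven` — ITS STATEMENT VERBATIM — FROM THE K2ᶜ INPUT FORM: the dual-exponential value datum
# (R3), the structural binders (ht′)/(tf)/(rk), characters / continuations / generic non-vanishing (r5′), and the ONE
# non-structural input, the divisibility `π^{m₀ + 2·v₇(N(α))} ∣ D.cZ·t′` of the EXPLICIT constant of block (R) — THEOREMS ONLY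

Cell bsd-cm, seat bsd-cm-prr-ty1 g30 (literature-prover), SUMMON `wake/SUMMON-bsd-cm-prr-ty1-20260830T1605Z.md` (903ea518e552576d),
pen D914 («THE v13 TOUCH … fires on ONE trigger: … an ASSEMBLY theorem whose CONCLUSION is the registered v12 letter VERBATIM»)
as SHARPENED by D916 («last conjunct `Φ.π ^ (m₀ + 2 * D.jα) ∣ D.cZ * t′` …; NO hz/hx needed in this direction»).  Imports block
(R) part 2 (`RamifiedSevenRationalComparisonOfInputs`: ★′ `periodScaledComparisonShape_of_inputs`) and through it (R3), (P3), (P1).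
HONEST LABEL: conditional theorems; every hypothesis displayed; debt 0; `stub_integralComparisonSeven` is NOT closed here (its
statement is DERIVED from the displayed input form `h`, which nobody has inhabited); stmt-BirchSwinnertonDyer-19945 is OPEN; no
summit statement is proved by this seat; `X12.CMRamifiedSeven` is NOT proved; BSD is claimed for no curve.

## The argument (two lines)

★′ of block (R) gives, at every admissible `𝔟`, `π^n • EU_𝔟 = ((wα⁻¹·(cZ·t′))·x̃_𝔟) • 𝐳_{γ′}` with `n = m₀ + 2jα`; if `π^n ∣ cZ·t′`,
say `cZ·t′ = π^n·c′`, then `π^n • (EU_𝔟 − (wα⁻¹·c′·x̃_𝔟) • 𝐳_{γ′}) = 0`, and `𝐇′(𝒱′)` has no `π`-torsion ((L4) `torsionFree_π`), so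
`EU_𝔟 = C • 𝐳_{γ′}` with `C = wα⁻¹·c′·x̃_𝔟 ∈ Λ_O` — `IntegralComparisonShape Φ` (`integralComparisonShape_of_periodScaled_of_dvd`).
Under the registered prefix this is the statement of `stub_integralComparisonSeven` (zp v12, `Cruxes/EllipticUnitValueSevenOfGZK/
Lines/kato_perrin_riou_zp.lean` l.472ff), copied byte-for-byte as the conclusion of ★ `integralComparisonSeven_of_inputs`.

## The input form `h` (= the prospective `stub_integralComparisonInputsSeven` of v13, pen D914; names free)

`★ → GZK → ∀ W ∈ 𝒞₇, ∀ (K, hK, γ, hγ, I), ∃ (F, θu) value-pinned, ∀ d, ∃ Φ : PinnedKatoGenusFrame W K hK I d, ∃ D : DualExpValueDatum hγ Φ,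
∃ (t′ : Φ.R) (m₀ : ℕ), Φ.t * t′ = Φ.π ^ m₀ ∧ (tf) ∧ (rk) ∧ hχ ∧ hL ∧ (r5′) ∧ Φ.π ^ (m₀ + 2 * D.jα) ∣ D.cZ * t′` — the last conjunct
is (KI) in EXPOSED coordinates (`α₀ α₁ e` inside `D.cZ`; at the constructible frame `t = 1`, `t′ = 1`, `m₀ = 0` it reads
`π^{2·v₇(α₀² + 7α₁²)} ∣ (α₀ − α₁π)·7^e·uStar⁻¹·7^k·u·π^a`), so the critic's falsifier (F-b) stays testable at construction time.

References: K. Kato, Astérisque 295 (2004) §15.16 (15.16.1) / Prop. 15.17 (p. 265), 15.14 (p. 264), Thm. 12.4 (2) (p. 221)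
[Kato2004Asterisque]; (P1) p776025, (P3) p776568, (R3) p781874, (R) p781873 + part 2; pen D911/D913/D914/D916; critic (619) verdict
(LEMMA P / (N★) PASS); memo `Cruxes/EllipticUnitValueSevenOfGZK/DivisibilityKernel-g64.md` REV 1.1 (bfa48bf0f321).
-/

noncomputable section

open scoped NumberField TensorProduct
open Field IsDedekindDomain NumberField Polynomial
open Literature.NumberTheory.GaloisRepresentations
open Literature.NumberTheory.EllipticCurves
open Literature.NumberTheory.EllipticCurves.Rank1Residual
open Literature.NumberTheory.EllipticCurves.IwasawaAlgebra
open Literature.NumberTheory.EllipticCurves.Kato2004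
open Literature.NumberTheory.ComplexMultiplication.EllipticUnits
open Summit.BirchSwinnertonDyer.Rank1Residual

namespace Summit.BirchSwinnertonDyer.Rank1Residual.Additive.GenusSeven

/-! ## §1 Period-scaled with a divisible constant ⇒ integral (π-torsion-freeness of `𝐇′(𝒱′)`) -/

section Frame

variable {W : WeierstrassCurve ℚ} [W.IsElliptic] [W.IsGloballyMinimal] [Fact (Nat.Prime 7)]
  [ContinuousSMul ℤ_[7] (W.tateModule 7)] {K : ZpExtension ℚ 7} {hK : K.IsCyclotomic}
  {γ : Field.absoluteGaloisGroup ℚ} {I : IwasawaH1Data W 7 K γ}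
  {F : GenusFrame} {θu : ∀ n : ℕ, globalUnitsOf (F.layer n)} {d : GenusDatum F θu}

/-- **Period-scaled comparison with `π^n ∣ c` ⇒ `IntegralComparisonShape`**: `π^n • EU_𝔟 = (c·x_𝔟) • 𝐳_{γ′}`, `c = π^n·c′` and
no `π`-torsion in `𝐇′(𝒱′)` give `EU_𝔟 = (c′·x_𝔟) • 𝐳_{γ′}`.  CONDITIONAL; nothing asserted.
[cite: Kato2004Asterisque, 15.14 (p. 264) and Thm. 12.4 (2) (p. 221, "torsion free")] -/
theorem integralComparisonShape_of_periodScaled_of_dvd (Φ : PinnedKatoGenusFrame W K hK I d)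
    {x : Ideal (𝓞 Φ.Kcm) → Φ.R} {n : ℕ} {c : Φ.R} (h : PeriodScaledComparisonShape Φ x n c) (hdvd : Φ.π ^ n ∣ c) :
    IntegralComparisonShape Φ := by
  intro 𝔟 h𝔟
  obtain ⟨c', hc'⟩ := hdvd
  refine ⟨c' * x 𝔟, ?_⟩
  have h1 := h 𝔟 h𝔟
  rw [hc', mul_assoc, mul_smul] at h1
  have h0 : Φ.π ^ n • (Φ.frame.EU 𝔟 - (c' * x 𝔟) • Φ.frame.zeta) = 0 := by
    rw [smul_sub, h1, sub_self]
  exact sub_eq_zero.mp (Φ.torsionFree_π_pow n _ h0)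

/-- **The K2ᶜ input form at ONE pinned frame ⇒ `IntegralComparisonShape Φ`** (★′ of block (R) + the divisibility of its
explicit constant + `integralComparisonShape_of_periodScaled_of_dvd`).  CONDITIONAL; nothing asserted; 19945 OPEN.
[cite: Kato2004Asterisque, (15.16.1) (p. 265), 15.14 (p. 264), Thm. 12.4 (2) (p. 221)] -/
theorem integralComparisonShape_of_inputs (hγ : K.IsTopGenerator γ) (Φ : PinnedKatoGenusFrame W K hK I d)
    (D : DualExpValueDatum hγ Φ) (t' : Φ.R) (m₀ : ℕ) (ht : Φ.t * t' = Φ.π ^ m₀)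
    (htf : ∀ (f : IwasawaAlgebra 7) (x : Φ.IK.H), f ≠ 0 → f • x = 0 → x = 0)
    (hrk : ∀ x y : Φ.IK.H, ∃ s r₀ r₁ : IwasawaAlgebra 7,
      (s ≠ 0 ∨ r₀ ≠ 0 ∨ r₁ ≠ 0) ∧ s • x = r₀ • y + r₁ • Φ.piK y)
    (hχ : ∀ n : ℕ, ∃ χ : absoluteGaloisGroup Φ.Kcm →ₜ* ℂˣ,
      (∀ σ ∈ (K.restrictOfFinrankEqTwo (by decide) Φ.Kcm Φ.finrank_Kcm).layerSubgroup (n + 1), χ σ = 1) ∧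
        IsPrimitiveRoot (((χ Φ.γK : ℂˣ)) : ℂ) (7 ^ (n + 1)))
    (hL : ∀ χ : absoluteGaloisGroup Φ.Kcm →ₜ* ℂˣ, ∃ Lf : ℂ → ℂ, CM.IsDepletedHeckeL Φ.ψ χ (7 * (7 * F.d)) Lf)
    (hRoh : ∃ n₁ : ℕ, ∀ n : ℕ, n₁ ≤ n → ∀ χ : absoluteGaloisGroup Φ.Kcm →ₜ* ℂˣ,
      (∀ σ ∈ (K.restrictOfFinrankEqTwo (by decide) Φ.Kcm Φ.finrank_Kcm).layerSubgroup (n + 1), χ σ = 1) →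
      IsPrimitiveRoot (((χ Φ.γK : ℂˣ)) : ℂ) (7 ^ (n + 1)) →
      ∀ Lf : ℂ → ℂ, CM.IsDepletedHeckeL Φ.ψ χ (7 * (7 * F.d)) Lf → Lf 1 ≠ 0)
    (hKI : Φ.π ^ (m₀ + 2 * D.jα) ∣ D.cZ * t') :
    IntegralComparisonShape Φ :=
  integralComparisonShape_of_periodScaled_of_dvd Φ
    (periodScaledComparisonShape_of_inputs hγ Φ D t' m₀ ht htf hrk hχ hL hRoh) (hKI.mul_left _)

end Frame

/-! ## §2 ★ The assembly: the statement of `stub_integralComparisonSeven` from the K2ᶜ input form -/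

/-- ★ **`integralComparisonSeven_of_inputs` — THE PINNED INTEGRAL COMPARISON (statement of zp v12's `stub_integralComparisonSeven`,
VERBATIM) FROM THE K2ᶜ INPUT FORM** `h` (module docstring): for every `W ∈ 𝒞₇` and cyclotomic datum, a value-pinned `(F, θu)` such
that every genus datum `d` carries a pinned frame `Φ`, a dual-exponential value datum `D`, `(t′, m₀)` with `t·t′ = π^{m₀}`, (tf),
(rk), characters of every primitive level, continuations, generic non-vanishing, AND the divisibility `π^{m₀ + 2jα} ∣ D.cZ·t′`.
On its landing the pen's v13 touch registers `stub_integralComparisonInputsSeven : <h>` and derives the v12 stub from it by this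
theorem (D914).  CONDITIONAL; nothing asserted; no stub closes; 19945 OPEN.
[cite: Kato2004Asterisque, §15.16 (15.16.1) (p. 265), 15.14 (p. 264), Prop. 15.9 (p. 258), Thm. 12.4 (2) / 12.5 (1) (p. 221), 13.5 (p. 227)] -/
theorem integralComparisonSeven_of_inputs
    (h : exists_zetaClassPosition_of_rank_le_one → rank_eq_analyticRank_of_analyticRank_le_one →
      ∀ (W : WeierstrassCurve ℚ) [W.IsElliptic] [W.IsGloballyMinimal] [Fact (Nat.Prime 7)], X12.ClassCSeven W →
      letI : ContinuousSMul ℤ_[7] (W.tateModule 7) := TateModule.continuousSMul_padicInt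
      ∀ (K : ZpExtension ℚ 7) (hK : K.IsCyclotomic) (γ : Field.absoluteGaloisGroup ℚ) (hγ : K.IsTopGenerator γ)
        (I : IwasawaH1Data W 7 K γ),
        ∃ (F : GenusFrame) (θu : ∀ n : ℕ, globalUnitsOf (F.layer n)), IsNormedEllipticUnitFamily F θu ∧
          ∀ d : GenusDatum F θu, ∃ Φ : PinnedKatoGenusFrame W K hK I d, ∃ D : DualExpValueDatum hγ Φ,
            ∃ (t' : Φ.R) (m₀ : ℕ), Φ.t * t' = Φ.π ^ m₀ ∧
            (∀ (f : IwasawaAlgebra 7) (x : Φ.IK.H), f ≠ 0 → f • x = 0 → x = 0) ∧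
            (∀ x y : Φ.IK.H, ∃ s r₀ r₁ : IwasawaAlgebra 7,
              (s ≠ 0 ∨ r₀ ≠ 0 ∨ r₁ ≠ 0) ∧ s • x = r₀ • y + r₁ • Φ.piK y) ∧
            (∀ n : ℕ, ∃ χ : absoluteGaloisGroup Φ.Kcm →ₜ* ℂˣ,
              (∀ σ ∈ (K.restrictOfFinrankEqTwo (by decide) Φ.Kcm Φ.finrank_Kcm).layerSubgroup (n + 1), χ σ = 1) ∧
                IsPrimitiveRoot (((χ Φ.γK : ℂˣ)) : ℂ) (7 ^ (n + 1))) ∧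
            (∀ χ : absoluteGaloisGroup Φ.Kcm →ₜ* ℂˣ, ∃ Lf : ℂ → ℂ, CM.IsDepletedHeckeL Φ.ψ χ (7 * (7 * F.d)) Lf) ∧
            (∃ n₁ : ℕ, ∀ n : ℕ, n₁ ≤ n → ∀ χ : absoluteGaloisGroup Φ.Kcm →ₜ* ℂˣ,
              (∀ σ ∈ (K.restrictOfFinrankEqTwo (by decide) Φ.Kcm Φ.finrank_Kcm).layerSubgroup (n + 1), χ σ = 1) →
              IsPrimitiveRoot (((χ Φ.γK : ℂˣ)) : ℂ) (7 ^ (n + 1)) →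
              ∀ Lf : ℂ → ℂ, CM.IsDepletedHeckeL Φ.ψ χ (7 * (7 * F.d)) Lf → Lf 1 ≠ 0) ∧
            Φ.π ^ (m₀ + 2 * D.jα) ∣ D.cZ * t') :
    Kato2004.exists_zetaClassPosition_of_rank_le_one → rank_eq_analyticRank_of_analyticRank_le_one →
    ∀ (W : WeierstrassCurve ℚ) [W.IsElliptic] [W.IsGloballyMinimal] [Fact (Nat.Prime 7)], X12.ClassCSeven W →
      letI : ContinuousSMul ℤ_[7] (W.tateModule 7) := TateModule.continuousSMul_padicInt
      ∀ (K : ZpExtension ℚ 7) (hK : K.IsCyclotomic) (γ : Field.absoluteGaloisGroup ℚ) (_ : K.IsTopGenerator γ)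
        (I : IwasawaH1Data W 7 K γ),
        ∃ (F : GenusSeven.GenusFrame) (θu : ∀ n : ℕ, globalUnitsOf (F.layer n)), GenusSeven.IsNormedEllipticUnitFamily F θu ∧
          ∀ d : GenusSeven.GenusDatum F θu, ∃ Φ : GenusSeven.PinnedKatoGenusFrame W K hK I d,
            GenusSeven.IntegralComparisonShape Φ := by
  intro hstar hGZK W _ _ _ hC K hK γ hγ I
  haveI : ContinuousSMul ℤ_[7] (W.tateModule 7) := TateModule.continuousSMul_padicInt
  obtain ⟨F, θu, hpin, hΦ⟩ := h hstar hGZK W hC K hK γ hγ I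
  refine ⟨F, θu, hpin, fun d => ?_⟩
  obtain ⟨Φ, D, t', m₀, ht, htf, hrk, hχ, hL, hRoh, hKI⟩ := hΦ d
  exact ⟨Φ, integralComparisonShape_of_inputs hγ Φ D t' m₀ ht htf hrk hχ hL hRoh hKI⟩

/-- **… and hence «K2cPinned» and the v11 letter `ResidueIsGenusUnitClassShape`** from the same input form ((P3)
`k2cPinned_of_integralComparison`).  CONDITIONAL; nothing asserted; 19945 OPEN. [cite: Kato2004Asterisque, §15.16 (15.16.1) (p. 265)] -/
theorem k2cPinned_of_inputs
    (h : exists_zetaClassPosition_of_rank_le_one → rank_eq_analyticRank_of_analyticRank_le_one →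
      ∀ (W : WeierstrassCurve ℚ) [W.IsElliptic] [W.IsGloballyMinimal] [Fact (Nat.Prime 7)], X12.ClassCSeven W →
      letI : ContinuousSMul ℤ_[7] (W.tateModule 7) := TateModule.continuousSMul_padicInt
      ∀ (K : ZpExtension ℚ 7) (hK : K.IsCyclotomic) (γ : Field.absoluteGaloisGroup ℚ) (hγ : K.IsTopGenerator γ)
        (I : IwasawaH1Data W 7 K γ),
        ∃ (F : GenusFrame) (θu : ∀ n : ℕ, globalUnitsOf (F.layer n)), IsNormedEllipticUnitFamily F θu ∧
          ∀ d : GenusDatum F θu, ∃ Φ : PinnedKatoGenusFrame W K hK I d, ∃ D : DualExpValueDatum hγ Φ,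
            ∃ (t' : Φ.R) (m₀ : ℕ), Φ.t * t' = Φ.π ^ m₀ ∧
            (∀ (f : IwasawaAlgebra 7) (x : Φ.IK.H), f ≠ 0 → f • x = 0 → x = 0) ∧
            (∀ x y : Φ.IK.H, ∃ s r₀ r₁ : IwasawaAlgebra 7,
              (s ≠ 0 ∨ r₀ ≠ 0 ∨ r₁ ≠ 0) ∧ s • x = r₀ • y + r₁ • Φ.piK y) ∧
            (∀ n : ℕ, ∃ χ : absoluteGaloisGroup Φ.Kcm →ₜ* ℂˣ,
              (∀ σ ∈ (K.restrictOfFinrankEqTwo (by decide) Φ.Kcm Φ.finrank_Kcm).layerSubgroup (n + 1), χ σ = 1) ∧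
                IsPrimitiveRoot (((χ Φ.γK : ℂˣ)) : ℂ) (7 ^ (n + 1))) ∧
            (∀ χ : absoluteGaloisGroup Φ.Kcm →ₜ* ℂˣ, ∃ Lf : ℂ → ℂ, CM.IsDepletedHeckeL Φ.ψ χ (7 * (7 * F.d)) Lf) ∧
            (∃ n₁ : ℕ, ∀ n : ℕ, n₁ ≤ n → ∀ χ : absoluteGaloisGroup Φ.Kcm →ₜ* ℂˣ,
              (∀ σ ∈ (K.restrictOfFinrankEqTwo (by decide) Φ.Kcm Φ.finrank_Kcm).layerSubgroup (n + 1), χ σ = 1) →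
              IsPrimitiveRoot (((χ Φ.γK : ℂˣ)) : ℂ) (7 ^ (n + 1)) →
              ∀ Lf : ℂ → ℂ, CM.IsDepletedHeckeL Φ.ψ χ (7 * (7 * F.d)) Lf → Lf 1 ≠ 0) ∧
            Φ.π ^ (m₀ + 2 * D.jα) ∣ D.cZ * t') :
    exists_zetaClassPosition_of_rank_le_one → rank_eq_analyticRank_of_analyticRank_le_one →
      ∀ (W : WeierstrassCurve ℚ) [W.IsElliptic] [W.IsGloballyMinimal] [Fact (Nat.Prime 7)], X12.ClassCSeven W →
      letI : ContinuousSMul ℤ_[7] (W.tateModule 7) := TateModule.continuousSMul_padicInt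
      ∀ (K : ZpExtension ℚ 7) (hK : K.IsCyclotomic) (γ : Field.absoluteGaloisGroup ℚ) (_ : K.IsTopGenerator γ)
        (I : IwasawaH1Data W 7 K γ),
        ∃ (F : GenusFrame) (θu : ∀ n : ℕ, globalUnitsOf (F.layer n)), IsNormedEllipticUnitFamily F θu ∧
          ∀ d : GenusDatum F θu, ∃ Φ : PinnedKatoGenusFrame W K hK I d,
            ResidueIsGenusUnitClassShape Φ.toKatoGenusFrame :=
  k2cPinned_of_integralComparison (integralComparisonSeven_of_inputs h)

end Summit.BirchSwinnertonDyer.Rank1Residual.Additive.GenusSeven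

end
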